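import Summits.BirchSwinnertonDyer.BirchSwinnertonDyer.Theorems.PrintCf2SplitBadTwoFramePinning
import Summits.BirchSwinnertonDyer.BirchSwinnertonDyer.Theorems.PrintCf2SplitBadTwoCMEndomorphismSqrtMinusSeven
import Summits.BirchSwinnertonDyer.BirchSwinnertonDyer.Theorems.PrintCf2SplitBadTwoFramePinningDirichlet
import Literature.NumberTheory.QuadraticFields.ImaginaryQuadraticPrescribedSplittingInert
import HarnessLib

set_option linter.dupNamespace false
set_option autoImplicit false

/-!
# Crux `PrintCf2.SplitBadTwoRankOneOfFacts` (stmt-BirchSwinnertonDyer-20368), road α — FRAME PINNING, III: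
# THE FRAME FIELD IS `ℚ(√−7)` — `L(ψ, s) = L(W, s)` for a Hecke character of an imaginary quadratic `K`
# with `2 ∤ d_K` forces `√−7 ∈ K`

Width seat `bsd-line-cf2-p1-w6` (brick B8 «pinning lemma», 2026-08-28); sequel of
`PrintCf2SplitBadTwoFramePinning.lean`. Helper `--supports` stmt-BirchSwinnertonDyer-20368; THEOREMS ONLY.

WHAT. The research stubs of skeleton v8 (`stub_rubinValueFormula_two`, `stub_ellipticUnitDescent_two`)
quantify over EVERY imaginary quadratic field `K` in which `2 = v v̄` splits and EVERY Hecke character `ψ`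
of `K` with `heckeLFunction ψ s = W.LSeries s` (`W ≅ cm7^{(d)}`, `j(W) = −3375`); the planned v9 reshape
(TURNKEY-20368-cmprimes-w2g7 / -plan 16:01:09Z) adds a binder `θ : K, θ² = −7` "true for `K₀ = ℚ(√−7)`;
the frames over other `K` are vacuous anyway". THIS FILE PROVES THE VACUITY, so no binder is needed:

* (§1 is the sibling file `PrintCf2SplitBadTwoFramePinningDirichlet.lean`: primes `ℓ` with `J(−m | ℓ) = −1`,
  `J(−7 | ℓ) = 1` beyond any bound, for `m ≡ 3 (mod 4)` with `7m` not a square — Dirichlet + CRT + reciprocity.)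
* §2 `exists_sq_eq_neg_seven_of_pinned` — **K-PINNING**: `K` imaginary quadratic with `2 ∤ d_K` (e.g. two
  distinct places above `2`), `W/ℚ` globally minimal elliptic with `j(W) = −3375`, `ψ` ANY Hecke character
  of `K` with `heckeLFunction ψ s = W.LSeries s` on `re s > 3/2` ⟹ **`∃ θ : K, θ² = −7`**. PROOF: `d_K =
  t² + 4m₀` is odd, so `d_K ≡ 1 (mod 4)`, `d_K = −m`, `m ≡ 3 (mod 4)`, and `(2ω − t)² = d_K` in `K`. If `7m =
  k²` then `θ = 7(2ω − t)/k`. Otherwise §1 gives a good prime `ℓ > max(7, m, |Δ_min(W)|)` inert in `K`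
  (`Quadratic.ncard_primesOver_eq_one_of_jacobiSym_eq_neg_one`: one prime `w` above `ℓ`, so `c • w = w`) and
  split in `ℚ(√−7)`; bsd-cm's `DeuringShape.isUnramifiedAt_and_values_of_pinned_of_hasGoodReduction`
  (inert case of the pinning) gives `a_ℓ(W) = 0`, whereas Deuring's criterion
  (`natCast_dvd_frobeniusTrace_iff_not_isSquare_of_reduction`, with the CM endomorphism `2π − 1`,
  `(2π − 1)² = −7`, of -w2 g7's `CMPrimes.exists_cmEndo_of_j_eq_neg3375`) gives `ℓ ∤ a_ℓ(W)` because `−7`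
  is a square mod `ℓ` — contradiction;
* §3 `exists_sq_eq_neg_seven_of_frame` — the same in the binder currency of the stubs (`C • W = cm7^{(d)}`,
  `v ≠ v̄` above `2`), together with `IsCMFieldOfJ K W.j` (the hypothesis of the Deuring print of S0′).

HONEST FRAMING: kernel theorems (Dirichlet's theorem is Mathlib's); nothing is claimed about BSD; no stub of
the skeleton is closed; 20368 stays OPEN. beyond-print theorem: no (Silverman ATAEC II §10 folklore: the
Grössencharacter of a CM curve lives on its CM field).

References: [IrelandRosen1990] Ch. 16 §1 (Dirichlet), Ch. 5 §2 (Jacobi reciprocity); [Marcus2018] Ch. 3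
Thm. 25; [SilvermanATAEC1994] II Prop. 4.4 (Deuring's criterion), Thm. 10.5; [Lang1987] Ch. 13 §4 Thm. 12.
-/

noncomputable section

open scoped Classical NumberTheorySymbols
open Filter NumberField IsDedekindDomain WeierstrassCurve
  Literature.NumberTheory.GaloisRepresentations
  Literature.NumberTheory.LFunctions
  Literature.NumberTheory.EllipticCurves
  Literature.NumberTheory.EllipticCurves.ModularForms
  Literature.NumberTheory.QuadraticFields
  Summit.BirchSwinnertonDyer.Rank1Residual
  Summit.BirchSwinnertonDyer.BirchSwinnertonDyer.Theorems.RamifiedSevenEllipticUnits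

namespace Summit.BirchSwinnertonDyer.BirchSwinnertonDyer.Theorems.PrintCf2.FramePinning

/-! ## §2 K-PINNING: the frame field of a character pinned to a curve with `j = −3375` is `ℚ(√−7)` -/

variable {K : Type} [Field K] [NumberField K]

/-- **The discriminant of a quadratic field with `2 ∤ d_K` is `≡ 1 (mod 4)`** (Stickelberger for quadratic
fields: `d_K = t² + 4m`). [cite: Marcus2018, Ch. 2 Thm. 1 and Ex. 27 (disc(1, ω) = t² + 4m)] -/
theorem discr_mod_four_eq_one_of_odd (h2 : Module.finrank ℚ K = 2) (hodd : ¬ (2 : ℤ) ∣ NumberField.discr K) :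
    NumberField.discr K % 4 = 1 := by
  obtain ⟨t, m, -, hD, -⟩ := Quadratic.exists_sq_eq_discr (K := K) h2
  rw [hD] at hodd ⊢
  rcases Int.even_or_odd t with ⟨k, rfl⟩ | ht
  · exact absurd ⟨(k + k) * k + 2 * m, by ring⟩ hodd
  · have := Int.sq_mod_four_eq_one_of_odd ht
    omega

/-- **An inert prime of a quadratic field carries exactly one place, fixed by every automorphism**:
if `J(d_K | ℓ) = −1` (`ℓ` prime) there is a place `w ∋ ℓ` with `c • w = w` for every `c ∈ Aut(K/ℚ)`
(`Quadratic.ncard_primesOver_eq_one_of_jacobiSym_eq_neg_one`). [cite: Marcus2018, Ch. 3 Thm. 25 (decomposition law, inert case)] -/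
theorem exists_place_smul_eq_self_of_jacobiSym_eq_neg_one (h2 : Module.finrank ℚ K = 2)
    {ℓ : ℕ} (hℓ : ℓ.Prime) (hJ : J(NumberField.discr K | ℓ) = -1) (c : K ≃ₐ[ℚ] K) :
    ∃ w : HeightOneSpectrum (𝓞 K), ((ℓ : ℕ) : 𝓞 K) ∈ w.asIdeal ∧ c • w = w := by
  have h1 := Quadratic.ncard_primesOver_eq_one_of_jacobiSym_eq_neg_one h2 hℓ hJ
  obtain ⟨Q, hQ⟩ := Set.ncard_eq_one.mp h1
  have hℓZ : Prime (ℓ : ℤ) := Nat.prime_iff_prime_int.mp hℓ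
  have hmem : ∀ P : Ideal (𝓞 K), P ∈ (Ideal.span {(ℓ : ℤ)}).primesOver (𝓞 K) ↔
      P.IsPrime ∧ ((ℓ : ℕ) : 𝓞 K) ∈ P := by
    intro P
    constructor
    · rintro ⟨hP, hover⟩
      refine ⟨hP, ?_⟩
      have h := (Ideal.liesOver_span_iff hP.ne_top hℓZ).mp hover
      simpa using h
    · rintro ⟨hP, hPℓ⟩
      exact ⟨hP, (Ideal.liesOver_span_iff hP.ne_top hℓZ).mpr (by simpa using hPℓ)⟩
  have hQmem : Q ∈ (Ideal.span {(ℓ : ℤ)}).primesOver (𝓞 K) := by rw [hQ]; exact Set.mem_singleton Q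
  obtain ⟨hQprime, hQℓ⟩ := (hmem Q).mp hQmem
  have hQne : Q ≠ ⊥ := by
    rintro rfl
    rw [Ideal.mem_bot] at hQℓ
    exact hℓ.ne_zero (by exact_mod_cast hQℓ)
  set w : HeightOneSpectrum (𝓞 K) := ⟨Q, hQprime, hQne⟩ with hw
  refine ⟨w, hQℓ, ?_⟩
  -- `c • w` is another prime above `ℓ`, hence equal to `w`
  have hcwℓ : ((ℓ : ℕ) : 𝓞 K) ∈ (c • w).asIdeal := by
    set u : HeightOneSpectrum (𝓞 ℚ) := w.under (𝓞 ℚ) with hu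
    have hgen : Rat.HeightOneSpectrum.natGenerator u = ℓ := natGenerator_under_eq_of_natCast_mem w hℓ hQℓ
    have h := (asIdeal_under_eq_iff_natCast_mem u (c • w)).mp (by rw [Rigidity.under_smul_asIdeal]; rfl)
    rwa [hgen] at h
  have hcw : (c • w).asIdeal ∈ (Ideal.span {(ℓ : ℤ)}).primesOver (𝓞 K) :=
    (hmem _).mpr ⟨(c • w).isPrime, hcwℓ⟩
  rw [hQ, Set.mem_singleton_iff] at hcw
  exact HeightOneSpectrum.ext hcw

/-- **K-PINNING.** Let `K` be an imaginary quadratic field with `2 ∤ d_K`, `W/ℚ` a globally minimal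
elliptic curve with `j(W) = −3375` (CM by `ℤ[(1+√−7)/2]`), and `ψ` ANY Hecke character of `K` with
`heckeLFunction ψ s = W.LSeries s` on `re s > 3/2`. Then `−7` is a square in `K`, i.e. `K = ℚ(√−7)`.
PROOF. `d_K ≡ 1 (mod 4)`, `d_K = −m`, `m ≡ 3 (mod 4)`, `δ² = d_K` in `𝓞 K`. If `7m = k²`, `θ = 7δ/k`.
Otherwise §1 supplies a prime `ℓ > max(7, m, |Δ_min(W)|)` with `J(d_K | ℓ) = −1` (ONE place `w` above
`ℓ`, `c • w = w`) and `J(−7 | ℓ) = 1`; the pinning read at the inert good prime `ℓ` (bsd-cm's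
`DeuringShape.isUnramifiedAt_and_values_of_pinned_of_hasGoodReduction`) gives `a_ℓ(W) = 0`, whereas
Deuring's criterion (`natCast_dvd_frobeniusTrace_iff_not_isSquare_of_reduction` for the endomorphism
`2π − 1`, `(2π − 1)² = −7`, of `CMPrimes.exists_cmEndo_of_j_eq_neg3375`) gives `ℓ ∤ a_ℓ(W)` — contradiction.
[cite: SilvermanATAEC1994, Ch. II Prop. 4.4 and Thm. 10.5 (the Grössencharacter lives on the CM field)]
[cite: Lang1987, Ch. 13 §4 Thm. 12 (Deuring's criterion)] [cite: IrelandRosen1990, Ch. 16 §1 Thm. 1 (Dirichlet)] -/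
theorem exists_sq_eq_neg_seven_of_pinned (hK : IsImaginaryQuadratic K)
    (hodd : ¬ (2 : ℤ) ∣ NumberField.discr K)
    (W : WeierstrassCurve ℚ) [W.IsElliptic] [W.IsGloballyMinimal] (hj : W.j = -3375)
    {ψ : HeckeCharacter K} (hpin : ∀ s : ℂ, 3 / 2 < s.re → heckeLFunction ψ s = W.LSeries s) :
    ∃ θ : K, θ ^ 2 = -7 := by
  have h2 : Module.finrank ℚ K = 2 := hK.1
  obtain ⟨t, m₀, δ, -, hδ⟩ := Quadratic.exists_sq_eq_discr (K := K) h2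
  set D : ℤ := NumberField.discr K with hDdef
  have hDneg : D < 0 := hK.discr_neg
  have hD4 : D % 4 = 1 := discr_mod_four_eq_one_of_odd h2 hodd
  set m : ℕ := D.natAbs with hmdef
  have hDm : D = -(m : ℤ) := by omega
  have hm4 : m % 4 = 3 := by omega
  have hδK : ((δ : 𝓞 K) : K) ^ 2 = (D : K) := by
    have h := congrArg (algebraMap (𝓞 K) K) hδ
    rwa [map_pow, map_intCast] at h
  by_cases hsqA : IsSquare (7 * m)
  · -- `7m = k²`: `θ = 7δ/k`
    obtain ⟨k, hk⟩ := hsqA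
    have hk0 : (k : K) ≠ 0 := by
      have : k ≠ 0 := fun h ↦ by rw [h, mul_zero] at hk; omega
      exact_mod_cast this
    refine ⟨7 * (δ : K) / k, ?_⟩
    have hkK : ((k : K)) ^ 2 = 7 * (m : K) := by exact_mod_cast (show k ^ 2 = 7 * m by rw [hk]; ring)
    rw [div_pow, mul_pow, hδK, hDm, div_eq_iff (pow_ne_zero 2 hk0)]
    push_cast
    linear_combination (7 : K) * hkK
  · exfalso
    obtain ⟨c, hc⟩ := QuadraticRamification.exists_algEquiv_ne_one_of_finrank_eq_two h2
    -- the CM endomorphism `φ = 2π − 1`, `φ² = −7`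
    obtain ⟨π, hπ, hππ, -, -⟩ := CMPrimes.exists_cmEndo_of_j_eq_neg3375 W hj
    have hφmem : (2 * π - 1 : AddMonoid.End W.geomPoints) ∈ W.geomEndRing :=
      sub_mem (mul_mem (natCast_mem W.geomEndRing 2) hπ) (one_mem _)
    have hφφ : (2 * π - 1 : AddMonoid.End W.geomPoints) * (2 * π - 1) =
        ((-7 : ℤ) : AddMonoid.End W.geomPoints) := by
      have h1 : (2 * π - 1 : AddMonoid.End W.geomPoints) * (2 * π - 1) = 4 * (π * π) - 4 * π + 1 := by
        noncomm_ring
      rw [h1, hππ, mul_sub]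
      push_cast
      abel_nf
      norm_num
    -- the Dirichlet prime
    obtain ⟨ℓ, hℓp, hℓn, hJm, hJ7⟩ :=
      exists_prime_jacobiSym_eq hm4 hsqA (max 7 (max m (minimalDiscriminantInt W).natAbs))
    haveI : Fact ℓ.Prime := ⟨hℓp⟩
    simp only [max_lt_iff] at hℓn
    obtain ⟨h7ℓ, hmℓ, hΔℓ⟩ := hℓn
    have hℓ2 : ℓ ≠ 2 := by omega
    have hℓ5 : 5 ≤ ℓ := by omega
    have hℓΔ : ¬ (ℓ : ℤ) ∣ minimalDiscriminantInt W :=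
      X12.natCast_not_dvd_of_natAbs_lt (minimalDiscriminantInt_ne_zero W) hΔℓ
    have hℓD : ¬ (ℓ : ℤ) ∣ NumberField.discr K :=
      X12.natCast_not_dvd_of_natAbs_lt (NumberField.discr_ne_zero K) (by rw [← hmdef]; exact hmℓ)
    have hℓ7 : ¬ (ℓ : ℤ) ∣ (-7 : ℤ) := X12.natCast_not_dvd_of_natAbs_lt (by norm_num) (by norm_num; omega)
    have hgood : W.HasGoodReductionAtPrime ℓ := hasGoodReductionAtPrime_of_not_dvd W ℓ hℓΔ
    -- inert in `K`: one place, fixed by `c`; the pinning gives `a_ℓ = 0`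
    have hJD : J(NumberField.discr K | ℓ) = -1 := by rw [← hDdef, hDm]; exact hJm
    obtain ⟨w, hw, hcw⟩ := exists_place_smul_eq_self_of_jacobiSym_eq_neg_one h2 hℓp hJD c
    have h0 : W.frobeniusTrace ℓ = 0 :=
      ((DeuringShape.isUnramifiedAt_and_values_of_pinned_of_hasGoodReduction h2 c hc hpin hgood hℓD
        w hw).2.2 hcw).1
    -- split in `ℚ(√−7)`: Deuring's criterion gives `ℓ ∤ a_ℓ`
    have hsq7 : IsSquare (((-7 : ℤ)) : ZMod ℓ) := ZMod.isSquare_of_jacobiSym_eq_one hJ7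
    have hndvd : ¬ (ℓ : ℤ) ∣ W.frobeniusTrace ℓ := fun h ↦
      ((natCast_dvd_frobeniusTrace_iff_not_isSquare_of_reduction
        Silverman1994_exists_reduction_ringHom_geomEndRing_holds W hφmem (by norm_num) hφφ ℓ hℓ2 hℓ7
        hℓΔ).mp h) hsq7
    exact hndvd (by rw [h0]; exact dvd_zero _)

/-- **The frame field is the CM field of `W`**: under the hypotheses of `exists_sq_eq_neg_seven_of_pinned`,
`IsCMFieldOfJ K W.j` (`[K : ℚ] = 2` and `d_K(j) = −7` is a square in `K`) — EXACTLY the hypothesis under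
which the print `Deuring_exists_heckeCharacter_of_maximalCM` (S0′ of the skeleton) supplies the
Grössencharacter of `W` over `K`. [cite: SilvermanATAEC1994, Ch. II Thm. 9.2 and Thm. 10.5 (the CM field carries ψ_E)] -/
theorem isCMFieldOfJ_of_pinned (hK : IsImaginaryQuadratic K) (hodd : ¬ (2 : ℤ) ∣ NumberField.discr K)
    (W : WeierstrassCurve ℚ) [W.IsElliptic] [W.IsGloballyMinimal] (hj : W.j = -3375)
    {ψ : HeckeCharacter K} (hpin : ∀ s : ℂ, 3 / 2 < s.re → heckeLFunction ψ s = W.LSeries s) :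
    IsCMFieldOfJ K W.j := by
  obtain ⟨θ, hθ⟩ := exists_sq_eq_neg_seven_of_pinned hK hodd W hj hpin
  refine ⟨hK.1, θ, ?_⟩
  rw [hθ, hj]
  norm_num [cmFieldDiscr]

/-! ## §3 In the binder currency of the 20368 stubs -/

/-- **K-PINNING OF THE 20368 FRAME.** For every member `W` of the split-bad class (`W/ℚ` globally minimal,
`C • W = cm7^{(d)}`, `d ≠ 0`), every imaginary quadratic `K` with two distinct places `v ≠ v̄` above `2`,
and every Hecke character `ψ` of `K` with `heckeLFunction ψ s = W.LSeries s` on `re s > 3/2` (no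
infinity type needed): `∃ θ : K, θ² = −7` and `IsCMFieldOfJ K W.j` — the frame field IS `ℚ(√−7)`; the
frames of `stub_rubinValueFormula_two` / `stub_ellipticUnitDescent_two` over any other `K` are VACUOUS, so
the v9 binder «`θ² = −7`» of TURNKEY-20368-cmprimes-w2g7 is a THEOREM of the v8 binders.
[cite: SilvermanATAEC1994, Ch. II Prop. 4.4, Thm. 10.5] [cite: IrelandRosen1990, Ch. 16 §1 Thm. 1] -/
theorem exists_sq_eq_neg_seven_of_frame {d : ℤ} (hd0 : d ≠ 0)
    (W : WeierstrassCurve ℚ) [W.IsElliptic] [W.IsGloballyMinimal] {C : VariableChange ℚ}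
    (hC : C • W = cm7.quadraticTwist (d : ℚ))
    (hK : IsImaginaryQuadratic K) {v vbar : HeightOneSpectrum (𝓞 K)}
    (hv : ((2 : ℕ) : 𝓞 K) ∈ v.asIdeal) (hvbar : ((2 : ℕ) : 𝓞 K) ∈ vbar.asIdeal) (hne : vbar ≠ v)
    {ψ : HeckeCharacter K} (hpin : ∀ s : ℂ, 3 / 2 < s.re → heckeLFunction ψ s = W.LSeries s) :
    (∃ θ : K, θ ^ 2 = -7) ∧ IsCMFieldOfJ K W.j := by
  have hdQ : (d : ℚ) ≠ 0 := by exact_mod_cast hd0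
  haveI := cm7.isElliptic_quadraticTwist hdQ
  have hj : W.j = -3375 := by
    have key : ∀ (V : WeierstrassCurve ℚ) [V.IsElliptic], V = cm7.quadraticTwist (d : ℚ) → V.j = -3375 := by
      rintro V _ rfl
      rw [j_quadraticTwist cm7 hdQ, j_cm7]
    rw [← variableChange_j W C]
    exact key (C • W) hC
  haveI : Fact (Nat.Prime 2) := ⟨Nat.prime_two⟩
  have hodd : ¬ (2 : ℤ) ∣ NumberField.discr K := by
    intro hdvd
    haveI := vbar.isPrime
    exact hne (HeightOneSpectrum.ext
      (LemmaXi.eq_asIdeal_of_dvd_discr (p := 2) hK.1 (by exact_mod_cast hdvd) v hv hvbar))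
  exact ⟨exists_sq_eq_neg_seven_of_pinned hK hodd W hj hpin, isCMFieldOfJ_of_pinned hK hodd W hj hpin⟩

end Summit.BirchSwinnertonDyer.BirchSwinnertonDyer.Theorems.PrintCf2.FramePinning

end
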